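import Mathlib.Analysis.Calculus.ImplicitContDiff
import Mathlib.Analysis.Calculus.ContDiff.RCLike
import Mathlib.Analysis.Calculus.Deriv.Comp
import Mathlib.Analysis.Calculus.Deriv.Shift
import Literature.Analysis.Calculus.ParametricCrossingTime
import HarnessLib

/-!
# Transit times and Poincaré maps of a `Cᵏ` local semiflow on a Banach space at a transversal
# affine section

Topic `Literature/Dynamics/Hyperbolic`.  Theorems only (no definitions, no named facts): the
implicit-function-theorem calculus behind POINCARÉ (section / return / transit) MAPS of a smooth local
semiflow on a real Banach space `E`, in the generality "a map `g : ℝ → E → E`, `(t, x) ↦ g t x`, jointly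
`Cᵏ` near a point `(t₀, x₀)`" — no semigroup law, no hyperbolicity, no invariant set is assumed, so the
results serve uniformly the non-uniformly hyperbolic closing lemma (Katok; Lian–Young for semiflows on
Hilbert spaces), its uniform / Anosov variant, and homoclinic polysection packages.

**Setting.** `x₁ := g t₀ x₀`; a SECTION through `x₁` is the affine hyperplane
`Σ = {z | ℓ (z − x₁) = 0}` of a continuous linear functional `ℓ : E →L[ℝ] ℝ`; it is TRANSVERSAL to
the orbit of `x₀` at time `t₀` iff `ℓ (∂ₜ g (t₀, x₀)) ≠ 0`, `∂ₜ g (t₀, x₀) = deriv (fun t => g t x₀) t₀`.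

**Content.**
* §1 `hasDerivAt_time_of_hasFDerivAt`, `hasFDerivAt_space_of_hasFDerivAt`, `deriv_time_eq`,
  `fderiv_space_eq` — the partial derivatives `∂ₜ g = A (1, 0)`, `D₂ g = A ∘ inr` of a jointly
  differentiable `g` with `A = D g (t₀, x₀)`;
* §2 `hasFDerivAt_poincareMap` — chain rule `D P = D₂ g + (D τ) ⊗ ∂ₜ g` for `P y = g (τ y) y`;
  `comp_fderiv_poincareMap_eq_zero` — if `P` lands in `Σ` near `x₀` then `ℓ ∘ D P (x₀) = 0` (`D P`
  takes values in the tangent hyperplane `ker ℓ`); `fderiv_transitTime_eq` — hence, under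
  transversality, `D τ (x₀) = −(ℓ ∘ D₂ g)/ℓ (∂ₜ g)`; `contDiffOn_poincareMap` — `P` is `Cᵏ` where `τ`
  is and `g` is jointly `Cᵏ` at `(τ y, y)`;
* §3 `derivWithin_Ici_eq_deriv_of_eventuallyEq` — under a (local) semigroup law
  `g (s + t₀) x₀ = g s (g t₀ x₀)`, `s ≥ 0` small, the one-sided flow direction
  `d/ds|_{s=0⁺} g s x₁` (`flowDir g x₁` of `HyperbolicSemiflowModel.lean`) equals `∂ₜ g (t₀, x₀)`, so
  transversality of `Σ` to the flow direction at `x₁` is the hypothesis used here;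
* §4 `exists_contDiffOn_transitTime` — TRANSIT TIME (P1): for `g` jointly `Cᵏ` at `(t₀, x₀)`
  (`k ≠ 0, ∞`; `ω` allowed) and `ℓ (∂ₜ g (t₀, x₀)) ≠ 0` there are `ε, η > 0` and `τ : E → ℝ`, `Cᵏ` on
  `ball x₀ ε`, `τ x₀ = t₀`, with `g (τ y) y ∈ Σ`, `(τ y, y)` in any prescribed neighbourhood `W` of
  `(t₀, x₀)`, `τ y ∈ (t₀ − η, t₀ + η)`, and `τ y` the ONLY time in that window at which the orbit of `y`
  meets `Σ` (`y ∈ ball x₀ ε`);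
* §5 `exists_transitTime_poincareMap` — the PACKAGE (P1)+(P2)+(P3): in addition the Poincaré map
  `P y = g (τ y) y` is `Cᵏ` on the ball, `τ` and `P` are `K`-Lipschitz there, transversality persists
  along `(τ y, y)`, and at EVERY `y ∈ ball x₀ ε` the derivative formulas
  `D τ (y) = −(ℓ (∂ₜ g))⁻¹ • ℓ ∘ D₂ g`, `D P (y) = D₂ g + (D τ (y)) ⊗ ∂ₜ g` hold (partials at `(τ y, y)`);
  `exists_transitTime_poincareMap_of_isOpen` — the same from `ContDiffOn` on an open `W ∋ (t₀, x₀)`.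

**Proofs.** (P1) is the tree's `Literature.Analysis.Calculus.exists_contDiffOn_crossingTime` (Mathlib's
`ContDiffAt.implicitFunction` / `contDiffAt_implicitFunction` / `eventually_apply_eq_iff_implicitFunction`
for one scalar equation with a Banach parameter) applied to `G y t = ℓ (g t y)`; the derivative formulas are
the chain rule (`HasFDerivAt.comp`, `HasFDerivAt.prodMk`, rank-one maps `ContinuousLinearMap.smulRight`)
and uniqueness of derivatives (`HasFDerivAt.unique`) applied to the locally constant `ℓ ∘ P`; Lipschitz
bounds are `ContDiffAt.exists_lipschitzOnWith`; persistence of transversality is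
`ContDiffAt.continuousAt_fderiv`.  Design: sections are affine hyperplanes of ONE functional (codimension
one is what closing / polysection arguments use; a finite-codimension version would replace `ℓ (∂ₜ g) ≠ 0`
by invertibility of a matrix); everything is localised in balls `ball x₀ ε` and time windows
`Ioo (t₀ − η) (t₀ + η)` rather than abstract neighbourhoods, so that consumers can count.

**Not here.** No semiflow axioms (beyond the optional §3), no hyperbolicity, no global sections or first-return
maps (the FIRST return needs orbit-segment geometry), no higher-codimension sections, no `k = ∞`.

## References

* S. Yu. Pilyugin, *Shadowing in Dynamical Systems*, LNM 1706, Springer (1999), §1.5 (shadowing for flows via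
  transversal sections and reparametrisation). [Pilyugin1999]
* D. Henry, *Geometric Theory of Semilinear Parabolic Equations*, LNM 840 (1981), Ch. 8 (Poincaré maps of
  semiflows in Banach spaces). [Henry1981]
-/

noncomputable section

open Set Metric Function Filter
open scoped Topology ContDiff NNReal

namespace Literature.Dynamics.Hyperbolic

variable {E : Type*} [NormedAddCommGroup E] [NormedSpace ℝ E]

/-! ## §1 Partial derivatives of a jointly differentiable `g : ℝ → E → E` -/

section Slices

variable {g : ℝ → E → E} {A : ℝ × E →L[ℝ] E} {t₀ : ℝ} {x₀ : E}

/-- The time slice `t ↦ g t x₀` of a jointly differentiable `g` has derivative `A (1, 0)`,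
`A = D g (t₀, x₀)`. [folklore] -/
theorem hasDerivAt_time_of_hasFDerivAt (hA : HasFDerivAt (fun q : ℝ × E => g q.1 q.2) A (t₀, x₀)) :
    HasDerivAt (fun t => g t x₀) (A (1, 0)) t₀ := by
  have h := (hA.comp t₀ (hasFDerivAt_prodMk_left t₀ x₀)).hasDerivAt
  simpa [Function.comp_def] using h

/-- The space slice `x ↦ g t₀ x` of a jointly differentiable `g` has derivative `A ∘ inr`,
`A = D g (t₀, x₀)`. [folklore] -/
theorem hasFDerivAt_space_of_hasFDerivAt (hA : HasFDerivAt (fun q : ℝ × E => g q.1 q.2) A (t₀, x₀)) :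
    HasFDerivAt (g t₀) (A.comp (ContinuousLinearMap.inr ℝ ℝ E)) x₀ := by
  have h := hA.comp x₀ (hasFDerivAt_prodMk_right t₀ x₀)
  simpa [Function.comp_def] using h

/-- `∂ₜ g (t₀, x₀) = D g (t₀, x₀) (1, 0)`. [folklore] -/
theorem deriv_time_eq (hA : HasFDerivAt (fun q : ℝ × E => g q.1 q.2) A (t₀, x₀)) :
    deriv (fun t => g t x₀) t₀ = A (1, 0) :=
  (hasDerivAt_time_of_hasFDerivAt hA).deriv

/-- `D₂ g (t₀, x₀) = D (g t₀) (x₀) = D g (t₀, x₀) ∘ inr`. [folklore] -/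
theorem fderiv_space_eq (hA : HasFDerivAt (fun q : ℝ × E => g q.1 q.2) A (t₀, x₀)) :
    fderiv ℝ (g t₀) x₀ = A.comp (ContinuousLinearMap.inr ℝ ℝ E) :=
  (hasFDerivAt_space_of_hasFDerivAt hA).fderiv

end Slices

/-! ## §2 The chain rule for `P y = g (τ y) y` and the derivative of a transit time -/

section Chain

variable {g : ℝ → E → E} {A : ℝ × E →L[ℝ] E} {x₀ : E} {τ : E → ℝ} {τ' : E →L[ℝ] ℝ}

/-- **Chain rule for a Poincaré-type map.** If `g` is jointly differentiable at `(τ x₀, x₀)` with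
derivative `A` and `τ` is differentiable at `x₀` with derivative `τ'`, then `P y = g (τ y) y` has derivative
`A ∘ inr + τ' ⊗ A (1, 0) = D₂ g + (D τ) ⊗ ∂ₜ g` at `x₀`. [folklore] -/
theorem hasFDerivAt_poincareMap (hA : HasFDerivAt (fun q : ℝ × E => g q.1 q.2) A (τ x₀, x₀))
    (hτ : HasFDerivAt τ τ' x₀) :
    HasFDerivAt (fun y => g (τ y) y)
      (A.comp (ContinuousLinearMap.inr ℝ ℝ E) + τ'.smulRight (A (1, 0))) x₀ := by
  have hf : HasFDerivAt (fun y => (τ y, y)) (τ'.prod (ContinuousLinearMap.id ℝ E)) x₀ :=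
    hτ.prodMk (hasFDerivAt_id x₀)
  have h2 : HasFDerivAt (fun y => g (τ y) y) (A.comp (τ'.prod (ContinuousLinearMap.id ℝ E))) x₀ :=
    HasFDerivAt.comp x₀ (f := fun y => (τ y, y)) hA hf
  have hEq : A.comp (τ'.prod (ContinuousLinearMap.id ℝ E)) =
      A.comp (ContinuousLinearMap.inr ℝ ℝ E) + τ'.smulRight (A (1, 0)) := by
    ext h
    have e : ((τ' h, h) : ℝ × E) = ((0 : ℝ), h) + τ' h • ((1 : ℝ), (0 : E)) := by ext <;> simp
    simp only [ContinuousLinearMap.comp_apply, ContinuousLinearMap.prod_apply,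
      ContinuousLinearMap.id_apply, add_apply, ContinuousLinearMap.inr_apply,
      ContinuousLinearMap.smulRight_apply]
    rw [e, map_add, map_smul]
  rwa [hEq] at h2

/-- **The differential of a Poincaré map is tangent to the section.** If moreover `P y = g (τ y) y`
lands in the affine hyperplane `{z | ℓ (z − P x₀) = 0}` for `y` near `x₀`, then `ℓ ∘ D P (x₀) = 0`.
(No transversality needed.) [folklore] -/
theorem comp_fderiv_poincareMap_eq_zero {ℓ : E →L[ℝ] ℝ}
    (hA : HasFDerivAt (fun q : ℝ × E => g q.1 q.2) A (τ x₀, x₀)) (hτ : HasFDerivAt τ τ' x₀)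
    (hsec : ∀ᶠ y in 𝓝 x₀, ℓ (g (τ y) y - g (τ x₀) x₀) = 0) :
    ℓ.comp (A.comp (ContinuousLinearMap.inr ℝ ℝ E) + τ'.smulRight (A (1, 0))) = 0 := by
  have hP := hasFDerivAt_poincareMap hA hτ
  have h1 : HasFDerivAt (fun y => ℓ (g (τ y) y - g (τ x₀) x₀))
      (ℓ.comp (A.comp (ContinuousLinearMap.inr ℝ ℝ E) + τ'.smulRight (A (1, 0)))) x₀ := by
    have := ℓ.hasFDerivAt.comp x₀ (hP.sub_const (g (τ x₀) x₀))
    simpa [Function.comp_def] using this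
  have h2 : HasFDerivAt (fun y => ℓ (g (τ y) y - g (τ x₀) x₀)) (0 : E →L[ℝ] ℝ) x₀ :=
    (hasFDerivAt_const (0 : ℝ) x₀).congr_of_eventuallyEq hsec
  exact h1.unique h2

/-- **Derivative of a transit time.** Under the hypotheses of `comp_fderiv_poincareMap_eq_zero` and
TRANSVERSALITY `ℓ (∂ₜ g) ≠ 0` (`∂ₜ g = A (1, 0)`), the derivative of `τ` at `x₀` is
`−(ℓ (∂ₜ g))⁻¹ • ℓ ∘ D₂ g`, i.e. `D τ (x₀) h = −ℓ (D₂ g h) / ℓ (∂ₜ g)`. [folklore] -/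
theorem fderiv_transitTime_eq {ℓ : E →L[ℝ] ℝ}
    (hA : HasFDerivAt (fun q : ℝ × E => g q.1 q.2) A (τ x₀, x₀)) (hτ : HasFDerivAt τ τ' x₀)
    (hsec : ∀ᶠ y in 𝓝 x₀, ℓ (g (τ y) y - g (τ x₀) x₀) = 0) (hℓ : ℓ (A (1, 0)) ≠ 0) :
    τ' = -(ℓ (A (1, 0)))⁻¹ • ℓ.comp (A.comp (ContinuousLinearMap.inr ℝ ℝ E)) := by
  have h3 := comp_fderiv_poincareMap_eq_zero hA hτ hsec
  ext h
  have h4 := congrArg (fun T : E →L[ℝ] ℝ => T h) h3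
  simp only [ContinuousLinearMap.comp_apply, add_apply, ContinuousLinearMap.smulRight_apply,
    zero_apply, map_add, map_smul, smul_eq_mul] at h4
  simp only [smul_apply, ContinuousLinearMap.comp_apply, smul_eq_mul]
  field_simp
  linarith

/-- **Smoothness of a Poincaré-type map.** If `τ` is `Cⁿ` on `V` and `g` is jointly `Cⁿ` at every
`(τ y, y)`, `y ∈ V`, then `P y = g (τ y) y` is `Cⁿ` on `V`. [folklore] -/
theorem contDiffOn_poincareMap {n : WithTop ℕ∞} {V : Set E} (hτ : ContDiffOn ℝ n τ V)
    (hg : ∀ y ∈ V, ContDiffAt ℝ n (fun q : ℝ × E => g q.1 q.2) (τ y, y)) :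
    ContDiffOn ℝ n (fun y => g (τ y) y) V := by
  intro y hy
  have h1 : ContDiffWithinAt ℝ n (fun z => (τ z, z)) V y := (hτ y hy).prodMk contDiffWithinAt_id
  exact ContDiffAt.comp_contDiffWithinAt (f := fun z => (τ z, z)) y (hg y hy) h1

end Chain

/-! ## §3 The flow direction after time `t₀` under a local semigroup law -/

section FlowDirection

variable {g : ℝ → E → E} {t₀ : ℝ} {x₀ : E}

/-- **Flow direction vs. time derivative along the orbit.** If `g (s + t₀) x₀ = g s (g t₀ x₀)` for all
small `s ≥ 0` (a local semigroup law; at `s = 0` it says `g 0 x₁ = x₁`, `x₁ = g t₀ x₀`) and the orbit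
`t ↦ g t x₀` is differentiable at `t₀`, then the one-sided flow direction at `x₁`,
`d/ds|_{s=0⁺} g s x₁ = derivWithin (fun s => g s x₁) (Ici 0) 0` (this is `flowDir g x₁`), equals
`∂ₜ g (t₀, x₀) = deriv (fun t => g t x₀) t₀`.  Hence a section transversal to the flow direction at `x₁`
is transversal in the sense `ℓ (deriv (fun t => g t x₀) t₀) ≠ 0` used below. [folklore] -/
theorem derivWithin_Ici_eq_deriv_of_eventuallyEq
    (hsg : ∀ᶠ s in 𝓝[≥] (0 : ℝ), g (s + t₀) x₀ = g s (g t₀ x₀))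
    (hd : DifferentiableAt ℝ (fun t => g t x₀) t₀) :
    derivWithin (fun s => g s (g t₀ x₀)) (Ici 0) 0 = deriv (fun t => g t x₀) t₀ := by
  -- the shifted orbit `s ↦ g (s + t₀) x₀` has derivative `deriv (g · x₀) t₀` at `s = 0`
  have h1 : HasDerivAt (fun s => g (s + t₀) x₀) (deriv (fun t => g t x₀) t₀) 0 := by
    have h : HasDerivAt (fun t => g t x₀) (deriv (fun t => g t x₀) t₀) (0 + t₀) := by
      rw [zero_add]; exact hd.hasDerivAt
    exact HasDerivAt.comp_add_const (f := fun t => g t x₀) 0 t₀ h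
  have h2 : derivWithin (fun s => g (s + t₀) x₀) (Ici 0) 0 = deriv (fun t => g t x₀) t₀ :=
    h1.hasDerivWithinAt.derivWithin (uniqueDiffOn_Ici 0 0 (mem_Ici.2 le_rfl))
  have h0 : g (0 + t₀) x₀ = g 0 (g t₀ x₀) := hsg.self_of_nhdsWithin (mem_Ici.2 le_rfl)
  have h3 : (fun s => g s (g t₀ x₀)) =ᶠ[𝓝[≥] (0 : ℝ)] fun s => g (s + t₀) x₀ :=
    hsg.mono fun s hs => hs.symm
  rw [h3.derivWithin_eq h0.symm, h2]

end FlowDirection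

/-! ## §4 Transit times (P1) -/

section TransitTime

variable [CompleteSpace E]

/-- **Transit time to a transversal section, `Cⁿ` in the initial state, with a uniqueness window (P1).**
Let `g : ℝ → E → E` be jointly `Cⁿ` at `(t₀, x₀)` (`n ≠ 0`, `n ≠ ∞`; `n = ω` allowed), `W` any
neighbourhood of `(t₀, x₀)`, `x₁ = g t₀ x₀`, and `ℓ : E →L[ℝ] ℝ` with `ℓ (∂ₜ g (t₀, x₀)) ≠ 0`.  Then there
are `ε, η > 0` and `τ : E → ℝ`, `Cⁿ` on `ball x₀ ε`, with `τ x₀ = t₀` and, for every `y ∈ ball x₀ ε`: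
`τ y ∈ (t₀ − η, t₀ + η)`, `(τ y, y) ∈ W`, `g (τ y) y` lies on the section `{z | ℓ (z − x₁) = 0}`, and `τ y`
is the ONLY `t ∈ (t₀ − η, t₀ + η)` with `ℓ (g t y − x₁) = 0`. [folklore] -/
theorem exists_contDiffOn_transitTime {n : WithTop ℕ∞} (hn : n ≠ 0) (hn' : n ≠ ∞)
    {g : ℝ → E → E} {t₀ : ℝ} {x₀ : E} {W : Set (ℝ × E)} (hW : W ∈ 𝓝 (t₀, x₀))
    (hg : ContDiffAt ℝ n (fun q : ℝ × E => g q.1 q.2) (t₀, x₀))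
    {ℓ : E →L[ℝ] ℝ} (hℓ : ℓ (deriv (fun t => g t x₀) t₀) ≠ 0) :
    ∃ ε > 0, ∃ η > 0, ∃ τ : E → ℝ, ContDiffOn ℝ n τ (ball x₀ ε) ∧ τ x₀ = t₀ ∧
      (∀ y ∈ ball x₀ ε, τ y ∈ Ioo (t₀ - η) (t₀ + η) ∧ (τ y, y) ∈ W ∧
        ℓ (g (τ y) y - g t₀ x₀) = 0) ∧
      ∀ y ∈ ball x₀ ε, ∀ t ∈ Ioo (t₀ - η) (t₀ + η), ℓ (g t y - g t₀ x₀) = 0 → t = τ y := by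
  -- the scalar equation `G y t = ℓ (g t y) = ℓ x₁`
  set G : E → ℝ → ℝ := fun y t => ℓ (g t y) with hG
  have hGcd : ContDiffAt ℝ n (uncurry G) (x₀, t₀) := by
    have h1 : ContDiffAt ℝ n (fun p : E × ℝ => (p.2, p.1)) (x₀, t₀) :=
      contDiffAt_snd.prodMk contDiffAt_fst
    have h2 : ContDiffAt ℝ n ((fun q : ℝ × E => g q.1 q.2) ∘ fun p : E × ℝ => (p.2, p.1)) (x₀, t₀) :=
      hg.comp (x₀, t₀) h1
    have h3 := ℓ.contDiff.contDiffAt.comp (x₀, t₀) h2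
    simpa [G, Function.comp_def, Function.uncurry_def] using h3
  have hA := (hg.differentiableAt hn).hasFDerivAt
  have hGd : deriv (G x₀) t₀ = ℓ (deriv (fun t => g t x₀) t₀) := by
    have h := ℓ.hasFDerivAt.comp_hasDerivAt t₀ (hasDerivAt_time_of_hasFDerivAt hA)
    rw [deriv_time_eq hA]
    simpa [G, Function.comp_def] using h.deriv
  have hspeed : deriv (G x₀) t₀ ≠ 0 := by rw [hGd]; exact hℓ
  obtain ⟨ε, hε, η, hη, τ, hτcd, hτ0, hτwin, hτuniq⟩ :=
    Literature.Analysis.Calculus.exists_contDiffOn_crossingTime hn hn' hGcd hspeed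
  -- shrink `ε` so that `(τ y, y) ∈ W`
  have hτc : ContinuousAt τ x₀ := (hτcd.contDiffAt (ball_mem_nhds x₀ hε)).continuousAt
  have hW' : ∀ᶠ y in 𝓝 x₀, (τ y, y) ∈ W := by
    have hc : ContinuousAt (fun y => (τ y, y)) x₀ := hτc.prodMk continuousAt_id
    have hW2 : W ∈ 𝓝 (τ x₀, x₀) := by rwa [hτ0]
    exact hc.preimage_mem_nhds hW2
  obtain ⟨ε₁, hε₁, hsub₁⟩ := Metric.mem_nhds_iff.1 hW'
  refine ⟨min ε ε₁, lt_min hε hε₁, η, hη, τ, hτcd.mono (ball_subset_ball (min_le_left _ _)), hτ0,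
    fun y hy => ?_, fun y hy t ht hsec => ?_⟩
  · have hy₀ : y ∈ ball x₀ ε := ball_subset_ball (min_le_left _ _) hy
    have hy₁ : y ∈ ball x₀ ε₁ := ball_subset_ball (min_le_right _ _) hy
    refine ⟨(hτwin y hy₀).1, hsub₁ hy₁, ?_⟩
    have h := (hτwin y hy₀).2
    simp only [G] at h
    rw [map_sub, sub_eq_zero]
    exact h
  · have hy₀ : y ∈ ball x₀ ε := ball_subset_ball (min_le_left _ _) hy
    refine hτuniq y hy₀ t ht ?_
    rw [map_sub, sub_eq_zero] at hsec
    simpa [G] using hsec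

end TransitTime

/-! ## §5 The package: transit time, Poincaré map, Lipschitz bounds, derivative formulas -/

section Package

variable [CompleteSpace E]

/-- **Transit time and Poincaré map of a `Cⁿ` local semiflow at a transversal affine section
((P1)+(P2)+(P3)).**  Let `g : ℝ → E → E` be jointly `Cⁿ` at `(t₀, x₀)` (`n ≠ 0, ∞`), `W` a neighbourhood
of `(t₀, x₀)`, `x₁ = g t₀ x₀`, `ℓ : E →L[ℝ] ℝ` with `ℓ (∂ₜ g (t₀, x₀)) ≠ 0`.  Then there are `ε, η > 0`,
`K ≥ 0` and a transit time `τ : E → ℝ` with `τ x₀ = t₀` such that, with the POINCARÉ MAP `P y = g (τ y) y`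
(`P x₀ = x₁`): `τ` and `P` are `Cⁿ` and `K`-Lipschitz on `ball x₀ ε`; for `y ∈ ball x₀ ε`, `τ y` lies in
the window `(t₀ − η, t₀ + η)`, `(τ y, y) ∈ W`, `P y ∈ Σ = {z | ℓ (z − x₁) = 0}` and `τ y` is the only time
in the window at which the orbit of `y` meets `Σ`; and at every `y ∈ ball x₀ ε`, `g` is jointly `Cⁿ` at
`(τ y, y)`, the section is still transversal there (`ℓ (∂ₜ g (τ y, y)) ≠ 0`), and
`D τ (y) = −(ℓ (∂ₜ g))⁻¹ • ℓ ∘ D₂ g`, `D P (y) = D₂ g + D τ (y) ⊗ ∂ₜ g` with the partial derivatives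
`∂ₜ g = deriv (fun t => g t y) (τ y)`, `D₂ g = fderiv ℝ (g (τ y)) y` taken at `(τ y, y)` (at `y = x₀`:
at `(t₀, x₀)`). [folklore] -/
theorem exists_transitTime_poincareMap {n : WithTop ℕ∞} (hn : n ≠ 0) (hn' : n ≠ ∞)
    {g : ℝ → E → E} {t₀ : ℝ} {x₀ : E} {W : Set (ℝ × E)} (hW : W ∈ 𝓝 (t₀, x₀))
    (hg : ContDiffAt ℝ n (fun q : ℝ × E => g q.1 q.2) (t₀, x₀))
    {ℓ : E →L[ℝ] ℝ} (hℓ : ℓ (deriv (fun t => g t x₀) t₀) ≠ 0) :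
    ∃ ε > 0, ∃ η > 0, ∃ K : ℝ≥0, ∃ τ : E → ℝ,
      τ x₀ = t₀ ∧ g (τ x₀) x₀ = g t₀ x₀ ∧
      ContDiffOn ℝ n τ (ball x₀ ε) ∧ ContDiffOn ℝ n (fun y => g (τ y) y) (ball x₀ ε) ∧
      LipschitzOnWith K τ (ball x₀ ε) ∧ LipschitzOnWith K (fun y => g (τ y) y) (ball x₀ ε) ∧
      (∀ y ∈ ball x₀ ε, τ y ∈ Ioo (t₀ - η) (t₀ + η) ∧ (τ y, y) ∈ W ∧
        ℓ (g (τ y) y - g t₀ x₀) = 0) ∧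
      (∀ y ∈ ball x₀ ε, ∀ t ∈ Ioo (t₀ - η) (t₀ + η), ℓ (g t y - g t₀ x₀) = 0 → t = τ y) ∧
      ∀ y ∈ ball x₀ ε,
        ContDiffAt ℝ n (fun q : ℝ × E => g q.1 q.2) (τ y, y) ∧
        ℓ (deriv (fun t => g t y) (τ y)) ≠ 0 ∧
        fderiv ℝ τ y = -(ℓ (deriv (fun t => g t y) (τ y)))⁻¹ • ℓ.comp (fderiv ℝ (g (τ y)) y) ∧
        fderiv ℝ (fun z => g (τ z) z) y =
          fderiv ℝ (g (τ y)) y + (fderiv ℝ τ y).smulRight (deriv (fun t => g t y) (τ y)) := by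
  set gu : ℝ × E → E := fun q => g q.1 q.2 with hgu
  have hA := (hg.differentiableAt hn).hasFDerivAt
  -- the refined constraint set: inside `W`, `g` jointly `Cⁿ`, transversality persists
  set W' : Set (ℝ × E) := W ∩ {q | ContDiffAt ℝ n gu q} ∩ {q | ℓ (fderiv ℝ gu q (1, 0)) ≠ 0}
    with hW'
  have hW'mem : W' ∈ 𝓝 (t₀, x₀) := by
    refine inter_mem (inter_mem hW (hg.eventually hn')) ?_
    have hc : ContinuousAt (fun q => ℓ (fderiv ℝ gu q (1, 0))) (t₀, x₀) :=
      ℓ.continuous.continuousAt.comp ((hg.continuousAt_fderiv hn).clm_apply continuousAt_const)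
    refine hc.eventually_ne ?_
    rw [← deriv_time_eq hA]
    exact hℓ
  obtain ⟨ε, hε, η, hη, τ, hτcd, hτ0, hτW, hτuniq⟩ :=
    exists_contDiffOn_transitTime hn hn' hW'mem hg hℓ
  -- pointwise data along `(τ y, y)`
  have hgy : ∀ y ∈ ball x₀ ε, ContDiffAt ℝ n gu (τ y, y) := fun y hy => (hτW y hy).2.1.1.2
  have hℓy : ∀ y ∈ ball x₀ ε, ℓ (fderiv ℝ gu (τ y, y) (1, 0)) ≠ 0 := fun y hy => (hτW y hy).2.1.2
  have hPcd : ContDiffOn ℝ n (fun y => g (τ y) y) (ball x₀ ε) := contDiffOn_poincareMap hτcd hgy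
  -- Lipschitz bounds near `x₀` (`1 ≤ n`)
  have h1n : (1 : WithTop ℕ∞) ≤ n := ENat.one_le_iff_ne_zero_withTop.mpr hn
  obtain ⟨K₁, s₁, hs₁, hK₁⟩ :=
    ((hτcd.contDiffAt (ball_mem_nhds x₀ hε)).of_le h1n).exists_lipschitzOnWith
  obtain ⟨K₂, s₂, hs₂, hK₂⟩ :=
    ((hPcd.contDiffAt (ball_mem_nhds x₀ hε)).of_le h1n).exists_lipschitzOnWith
  obtain ⟨ε₁, hε₁, hsub₁⟩ := Metric.mem_nhds_iff.1 (inter_mem hs₁ hs₂)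
  -- the final radius
  have hb : ball x₀ (min ε ε₁) ⊆ ball x₀ ε := ball_subset_ball (min_le_left _ _)
  have hb₁ : ball x₀ (min ε ε₁) ⊆ ball x₀ ε₁ := ball_subset_ball (min_le_right _ _)
  refine ⟨min ε ε₁, lt_min hε hε₁, η, hη, max K₁ K₂, τ, hτ0, by rw [hτ0], hτcd.mono hb, hPcd.mono hb,
    (hK₁.weaken (le_max_left _ _)).mono fun y hy => (hsub₁ (hb₁ hy)).1,
    (hK₂.weaken (le_max_right _ _)).mono fun y hy => (hsub₁ (hb₁ hy)).2,
    fun y hy => ⟨(hτW y (hb hy)).1, (hτW y (hb hy)).2.1.1.1, (hτW y (hb hy)).2.2⟩,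
    fun y hy => hτuniq y (hb hy), fun y hy => ?_⟩
  -- derivative formulas at `y`
  have hy' : y ∈ ball x₀ ε := hb hy
  have hAy := ((hgy y hy').differentiableAt hn).hasFDerivAt
  have hτy : HasFDerivAt τ (fderiv ℝ τ y) y :=
    ((hτcd.contDiffAt (isOpen_ball.mem_nhds hy')).differentiableAt hn).hasFDerivAt
  have hsec : ∀ᶠ z in 𝓝 y, ℓ (g (τ z) z - g (τ y) y) = 0 := by
    filter_upwards [isOpen_ball.mem_nhds hy'] with z hz
    have h1 := (hτW z hz).2.2
    have h2 := (hτW y hy').2.2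
    rw [map_sub, sub_eq_zero] at h1 h2 ⊢
    rw [h1, h2]
  have hdy : deriv (fun t => g t y) (τ y) = fderiv ℝ gu (τ y, y) (1, 0) := deriv_time_eq hAy
  have hℓy' : ℓ (fderiv ℝ gu (τ y, y) (1, 0)) ≠ 0 := hℓy y hy'
  refine ⟨hgy y hy', by rw [hdy]; exact hℓy', ?_, ?_⟩
  · rw [hdy, fderiv_space_eq hAy]
    exact fderiv_transitTime_eq hAy hτy hsec hℓy'
  · rw [hdy, fderiv_space_eq hAy]
    exact (hasFDerivAt_poincareMap hAy hτy).fderiv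

/-- The package `exists_transitTime_poincareMap` for `g` jointly `Cⁿ` on an OPEN set `W ∋ (t₀, x₀)` of
`ℝ × E` (the form in which a `Cⁿ` local semiflow on an open subset `U` of `E` presents itself:
`W = (0, T) ×ˢ U`). [folklore] -/
theorem exists_transitTime_poincareMap_of_isOpen {n : WithTop ℕ∞} (hn : n ≠ 0) (hn' : n ≠ ∞)
    {g : ℝ → E → E} {W : Set (ℝ × E)} (hWo : IsOpen W) {t₀ : ℝ} {x₀ : E} (hmem : (t₀, x₀) ∈ W)
    (hg : ContDiffOn ℝ n (fun q : ℝ × E => g q.1 q.2) W)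
    {ℓ : E →L[ℝ] ℝ} (hℓ : ℓ (deriv (fun t => g t x₀) t₀) ≠ 0) :
    ∃ ε > 0, ∃ η > 0, ∃ K : ℝ≥0, ∃ τ : E → ℝ,
      τ x₀ = t₀ ∧ g (τ x₀) x₀ = g t₀ x₀ ∧
      ContDiffOn ℝ n τ (ball x₀ ε) ∧ ContDiffOn ℝ n (fun y => g (τ y) y) (ball x₀ ε) ∧
      LipschitzOnWith K τ (ball x₀ ε) ∧ LipschitzOnWith K (fun y => g (τ y) y) (ball x₀ ε) ∧
      (∀ y ∈ ball x₀ ε, τ y ∈ Ioo (t₀ - η) (t₀ + η) ∧ (τ y, y) ∈ W ∧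
        ℓ (g (τ y) y - g t₀ x₀) = 0) ∧
      (∀ y ∈ ball x₀ ε, ∀ t ∈ Ioo (t₀ - η) (t₀ + η), ℓ (g t y - g t₀ x₀) = 0 → t = τ y) ∧
      ∀ y ∈ ball x₀ ε,
        ContDiffAt ℝ n (fun q : ℝ × E => g q.1 q.2) (τ y, y) ∧
        ℓ (deriv (fun t => g t y) (τ y)) ≠ 0 ∧
        fderiv ℝ τ y = -(ℓ (deriv (fun t => g t y) (τ y)))⁻¹ • ℓ.comp (fderiv ℝ (g (τ y)) y) ∧
        fderiv ℝ (fun z => g (τ z) z) y =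
          fderiv ℝ (g (τ y)) y + (fderiv ℝ τ y).smulRight (deriv (fun t => g t y) (τ y)) :=
  exists_transitTime_poincareMap hn hn' (hWo.mem_nhds hmem) (hg.contDiffAt (hWo.mem_nhds hmem)) hℓ

end Package

end Literature.Dynamics.Hyperbolic
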